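import Summits.ResolutionOfSingularities.ResolutionOfSingularities.Theorems.WeightedInvariantLocalWeightedDropNCGameTransport
import Summits.ResolutionOfSingularities.ResolutionOfSingularities.Theorems.WeightedInvariantLocalWeightedDropNCResPhaseAssembly
import Summits.ResolutionOfSingularities.ResolutionOfSingularities.Theorems.WeightedInvariantLocalWeightedDropNCGameRankTupleDrop
import Summits.ResolutionOfSingularities.ResolutionOfSingularities.Theorems.WeightedInvariantLocalWeightedDropNCResSettingHeadDrop
import Summits.ResolutionOfSingularities.ResolutionOfSingularities.Theorems.WeightedInvariantLocalWeightedDropTOT2E1Decorated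
import Summits.ResolutionOfSingularities.ResolutionOfSingularities.Theorems.WeightedInvariantLocalWeightedDropNCEndgameOrdOrderOne


/-!
# `LocalWeightedDrop`: RD-ALIGNMENT of the wild residuals and the DIRECTRIX CUT of the equimultiple phase
# (strategist line `directrix-cut` for W4|₄ = `stub_wildWideApexFourStartsWon`; the phase assembly is generic in the dimension)

[ADOPTION RECORD: this tree module is one of four files (`…NCDirectrixCutAlign` ← `…NCDirectrixCutPhase` ← `…NCDirectrixCutHist` ←
`…NCDirectrixCut`) into which res-L1-w43-stub-4 (gen 5, adoption hand, 2026-08-27) split res-L1-w43-strat-1's farm-clean strategist module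
`L/res-L1-w43-strat-1/g8/directrix_cut_v3_1.lean` (sha16 25b57d7ac1dae990, gens 7–8; offer (i) 14:58:21Z), because of the lint «Theorems files with
proofs ≤ 400 lines».  Declaration texts are VERBATIM with ONE systematic edit: the notational `abbrev Decoration.IsInv` of the source is UNFOLDED in
place and not declared (res-L1-w43-lead-1's regime vocabulary `…NCResRegimeDefs` declares `Decoration.IsInv` with the same meaning).  Author of the
mathematics and the text: res-L1-w43-strat-1.  The module-level commentary below is the author's, kept whole in each part for context.]

THIS PART (1/4): §1 — the ordinal transport and the v32 residuals BY NAME from (RD).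

[OURS · L1 W4.3 · chain w43 · ENGINE crux `LocalWeightedDrop` stmt-ResolutionOfSingularities-8899; registered skeleton of record v32
(`L/res-L1-w43-lead-1/g4/LocalWeightedDrop_v32.lean`, sha16 ddb48572591139d5, registrar res-L1-w43-lead-1); strategist res-L1-w43-strat-1 gens 7–8 (v3: §5–§6 added in gen 8).
Game bookkeeping over the programme's own NC count game (res-type-056 / res-L1-w43-stub-1's S-SET decorations); NOT a statement of any manuscript;
AI-produced, weaker than expert review.  This file closes NO registered stub by name: it proves the residuals WITH EXTRA HYPOTHESES (named below).]

## §1  RD-alignment: the ORDINAL transport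
`won_of_winsOrd` — the transport `won_of_winsIn` (p507842) with well-founded induction on the GAME VALUE instead of the round number: a
TRANSFINITELY winnable position of the NC count game (`WinsOrd GermIsNC α b`, …NCGameRank) makes every divisor of a power of `b` a won germ of the
weighted game.  Hence the residual stubs follow BY NAME from the ORDINAL RANK-DROP statement
  (RD_m)  `∃ ρ : k⟦x₀..x_m⟧ → Ordinal, ∀ b ≠ 0, ¬ GermIsNC b → ∃ smooth-centre move, ρ drops at every answer`
— literally the text of the registered stub `stub_spaceNCRankDrop` (m = 2) one dimension up — instead of the uniform-in-the-answers finite round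
bound (TOT_m) of p507842: `wildWideApexFourStartsWon_of_ncRankDrop` (W4|₄ ⇐ RD₃), `wildWideApexFiveUpStartsWon_of_ncRankDrop` (W4|₅₊ ⇐ RD_{n+4}),
and — the tame maximal-contact DIMENSION DROP, ordinal form of res-type-088's `tameWideApexHigherStartsWon_of_tot_of_mono` (p506334) —
`tameWideApexFiveUpStartsWon_of_ncRankDropBelow` (T″|₅₊ at `N = n + 5` ⇐ RD_{n+3}, i.e. the NC game in ONE FEWER variable, through
`TameLift.tameWon_of_tupleDrop` + `tupleDrop_of_rank_of_monomialPhase` + `germMonomialPhase`).  So T″|₅ and W4|₄ cost the SAME statement RD₃.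

## §2  The PHASE ASSEMBLY — REBASED (v2) on res-L1-w43-stub-1's landed `…NCResPhaseAssembly` (p534993: product states `k⟦x⟧ × Decoration k m`,
germ `Prod.fst`, `Admissible` carried in the targets; `dWinsTo_germIsNC_of_headPhase`, `ncRankDrop_of_headPhase`, `ncRankDrop_of_highPhase_of_rung`).
This file adds only: `HighExit m` (the `o ≥ 2` phase WITH the normal-crossing exit — CJS-faithful: Σ^{O,max} is eliminated OR the germ resolves;
stub-1's exit-free `hhigh` implies it, `highExit_of_high`), the ORDINAL endgame (`EndOrd m`, `endOrd_of_endR8`, `DWinsTo.of_winsOrd` = transfinite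
wins are decorated wins, `dWinsTo_end_of_ordRung`, `endPhase_of_ordRung[']`), and `rd_of_highExit_of_end` / `rd_of_highExit_of_ordRung :
HighExit m → EndOrd m → RD_m` (so that the rank-drop statement one dimension LOWER can feed the endgame — see the card, stub E).

## §3  The DIRECTRIX CUT of a phase (every `m`; the new decomposition)
`UnaryVertex δ` := the initial form of the TOTAL-WITH-HISTORY `f̃ = f · ∏_{l ∈ O} X_l` (order `c = o + |O|`; TOT2-LINE v1.1 (B): e(f̃) = e^O) is
invariant under `m` linearly independent translations — i.e. `in_c(f̃) = λ·ℓ^c` is a power of ONE linear form, `e(f̃) = m = dim X`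
(over an algebraically closed field the translation-invariance vectors of a form are exactly its directrix: a homogeneous additive stabiliser is a
linear subspace, and invariance under a whole subspace `W` means the form lies in `Sym((V/W)^*)`).  The phase splits as
  `CoreUnary m` := from `e(f̃) = m`, `o ≥ 2`: reach «NC ∨ head drops ∨ (same head ∧ e(f̃) < m)» — split further into `CoreUnaryTame p m`
                   (`O ≠ ∅ ∨ p ∤ o`: maximal contact exists) and `CoreUnaryWild p m` (`O = ∅ ∧ p ∣ o`), classes preserved along equal heads;
  `TermLow m`   := from `e(f̃) < m`, `o ≥ 2`: reach «NC ∨ head drops»;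
  `phase_of_dirCut : CoreUnary m → TermLow m → Phase m` (`DWinsTo.bind`; a state with the same head has the same `o ≥ 2`).
WHY THIS CUT (m = 3, threefold hypersurface germs in 4-space, the wild residual W4|₄).  Cossart–Jannsen–Saito (LNM 2270 = arXiv:0905.2191) p.9:
«the proofs in §§11–13 show that [the key termination] Theorems 5.35 and 5.40 hold for X of ARBITRARY dimension, with the condition that the
geometric dimension of the directrix is ≤ 2»; Thm 2.10(4) (e does not increase at near points) is characteristic- and dimension-free; Thm 2.14
(near points lie on ℙ(Dir)) needs «char ≥ dim X/2 + 1» only through Hironaka's group scheme `B_{P,x′}`, which at a RATIONAL point `x′` is the line of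
`x′` — so at the closed points of our games over `k = k̄` it holds in every characteristic.  Hence `TermLow 3` is CJS-transcription (XL, in print modulo
the quoted remark), `EndOrd 3` is embedded resolution of the boundary-trace SURFACES in the regular threefold `V(f)` (CJS Thm 0.3, dimension two in a
regular ambient scheme of any dimension: in print; inside the programme it is the rank-drop statement `RD 2` — the registered `stub_spaceNCRankDrop` —
plus a sheet-separation lift, see the card), and `CoreUnary 3` — `in_c(f̃) = z^c`, `p ∣ o` forced by the engine's tangent-cone cuts — is THE OPEN
THREEFOLD CORE (the hypersurfaces `z^{p e} + …` of Cossart–Piltant 2008-II, known only by local uniformization).  At `m = 2` the same cut separates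
TOT2-LINE's S-E2′ (unary vertex, the polyhedron regime) from S-E1/S-E0/S-CRV.

## §4  BY NAME
`wildWideApexFourStartsWon_of_dirCut : CoreUnaryWild₃ → CoreUnaryTame₃ → TermLow₃ → EndOrd₃ → W4|₄` (statement of the registered stub VERBATIM), sorry-free;
`spaceNCRankDrop_of_dirCut : CoreUnary₂ → TermLow₂ → EndOrd₂ → (text of stub_spaceNCRankDrop)`.
## §5  The HISTORY-FIRST cut (v3, every `m`) — the cut of record for the line from gen 8 on
`OldExit m` (an old letter is present: the old component is a RIGID hypersurface of maximal contact for free — (P2) + «same head keeps `|O|`»; at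
`m = 3` its content is Kawanoue–Matsuki's IFP resolution in ambient dimension 3, arXiv:1205.4556, applied on the old component, modulo the game
dictionary) · `FreeLow m` (`O = ∅`, `f` not unary: the GENUINE CJS regime — condition (3e) `e_x ≤ 2` holds at `m = 3`) · `FreeTame p m` (`O = ∅`, unary,
`p ∤ o`: Giraud contact + the same threefold marked-ideal game) · `CoreUnaryWild p m` (unchanged: THE open core); `highExit_of_histCut`, `rd_of_histCut`.
The apex sub-cut of `FreeLow`: its `e = 0` and `e = 1`-isolated parts are TREE THEOREMS for every `m` (`dWinsTo_headDrop_of_apexTrivial` p537041,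
`TOT2E1.dWinsTo_headDrop_of_isolated` p536552), leaving `ApexLineCurveExit m` (`e = 1` on an equimultiple formal curve; L, OURS) and `ApexPlaneExit m`
(`2 ≤ e ≤ m - 1`; at `m = 3`: CJS Thms 5.35/5.40 one ambient dimension up; XXL): `freeLow_of_apexCut`, `rd_of_histApexCut`.
ERRATUM to §3's reading «`TermLow 3` is CJS-transcription»: `TermLow` (v2) contains the states «`|O| = 1`, `e_x(f) = 3`, `p ∣ o`» for which CJS
Thm 5.28 (3e) fails; they belong to `OldExit` (Kawanoue–Matsuki on the old component), which is why v3 cuts by the history FIRST.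

`endOrd_of_rd : RD k m → EndOrd k (m + 1)` — stub E of the line IS the registered door stub one dimension lower (res-D-pv-006 p539872
`NCTransport.exists_winsOrd_orderOne_mul_prod_of_rankDrop`); `rd_succ_of_histApexCut` = the inductive form (RD_{m+1}) ⟸ five pieces + (RD_m).

## §6  BY NAME (v3)
`wildWideApexFourStartsWon_of_histCut : CoreUnaryWild₃ → FreeTame₃ → OldExit₃ → ApexLineCurveExit₃ → ApexPlaneExit₃ → (door text) → W4|₄`
(W4|₄ and the door `stub_spaceNCRankDrop` both VERBATIM from v32), sorry-free; `rd_three_of_histCut` (the five pieces + `RD k 2` give `RD k 3`, which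
T″|₅ consumes through `tameWideApexFiveUpStartsWon_of_ncRankDropBelow`).
-/


set_option linter.dupNamespace false -- mandated namespace of this single-conjunct summit

noncomputable section

open Literature.AlgebraicGeometry.Resolution

namespace Summit.ResolutionOfSingularities.ResolutionOfSingularities.Theorems

namespace NCTransport

open MvPowerSeries TameFourTupleDrop

variable {k : Type} [Field k]

/-! ## §1 The ordinal transport -/

/-- **A TRANSFINITELY WINNABLE POSITION OF THE NC COUNT GAME WINS THE WEIGHTED GAME** (OURS · L1 W4.3; `won_of_winsIn` p507842 with
well-founded induction on the game value `α`): if `WinsOrd GermIsNC α b` (some ranked winning region towards normal-crossing support contains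
`b` with rank `≤ α`), then every divisor `f` of a power of `b` is in `CobordantGame.Won k (m + 1)` — play the region's move as the weighted move;
every exceptional point is tame (weights `≤ 1`); the successor's slice divides a power of the new position, whose value is smaller. -/
theorem won_of_winsOrd (p : ℕ) (hp : p.Prime) [CharP k p] {m : ℕ} (α : Ordinal.{0}) :
    ∀ (b : MvPowerSeries (Fin (m + 1)) k), b ≠ 0 → WinsOrd GermIsNC α b →
      ∀ (N : ℕ) (f : MvPowerSeries (Fin (m + 1)) k), f ∣ b ^ (N + 1) → CobordantGame.Won k (m + 1) f := by
  induction α using WellFoundedLT.induction with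
  | ind α ih =>
  intro b hb hwin N f hfb
  by_cases hnc : GermIsNC b
  · exact won_of_germIsNC hb hnc N f hfb
  obtain ⟨Φ, w, hmv, hclause⟩ := hwin.exists_move hnc
  obtain ⟨hΦ0, hdet, hw1, hwpos⟩ := hmv
  refine CobordantGame.Won.move Φ w ⟨hΦ0, hdet, hwpos⟩ fun g hg => ?_
  obtain ⟨c, a, ⟨i₀, hwi₀, hci₀⟩, hfacf, -, -⟩ := hg
  -- the exceptional point under the convention `c'ᵢ = 0` on the weight-`0` slots
  obtain ⟨c', hc'def⟩ : ∃ c' : Fin (m + 1) → k, c' = fun l => if 0 < w l then c l else 0 := ⟨_, rfl⟩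
  have hc' : ∀ l, w l = 0 → c' l = 0 := fun l hl => by simp [hc'def, hl]
  have hc'0 : c' ≠ 0 := by
    intro h
    have h1 := congr_fun h i₀
    simp [hc'def, hwi₀] at h1
    exact hci₀ h1
  have hcc : CobordantGame.cruxChart k w c = CobordantChart.chart w c' := by
    rw [hc'def]; exact CobordantChart.cruxChart_eq_chart w c
  rw [hcc] at hfacf
  have hΦs : HasSubst Φ := hasSubst_of_constantCoeff_zero hΦ0
  have hch := CobordantChart.hasSubst_chart w c' hc'
  -- `b`'s transform and its `s`-saturation; the region's live slot and the smaller value there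
  have hB : subst (CobordantChart.chart w c') (subst Φ b) ≠ 0 :=
    CobordantChart.subst_chart_ne_zero w c' hc' (FormalCoordChange.subst_ne_zero_of_isUnit_det hΦ0 hdet hb)
  obtain ⟨Ab, Gb, hfacb, hGb⟩ := CobordantVertexChart.exists_eq_X_pow_mul_not_dvd hB
  obtain ⟨i, hci, β, hβ, hwini⟩ := hclause c' hc' hc'0 Ab Gb hfacb hGb
  have hwi : 0 < w i := by
    by_contra h
    exact hci (hc' i (by omega))
  -- `f ∣ b^(N+1)` transported through `Φ`, the chart and the saturations: `g ∣ s^r · G_b^(N+1)`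
  obtain ⟨q, hq⟩ := hfb
  have hdiv : X 0 ^ a * g ∣ X 0 ^ (Ab * (N + 1)) * Gb ^ (N + 1) := by
    have hTb : (subst (CobordantChart.chart w c') (subst Φ b)) ^ (N + 1) =
        subst (CobordantChart.chart w c') (subst Φ f) * subst (CobordantChart.chart w c') (subst Φ q) := by
      rw [← coe_substAlgHom hΦs, ← coe_substAlgHom hch, ← map_pow, ← map_pow, hq, map_mul, map_mul]
    refine ⟨subst (CobordantChart.chart w c') (subst Φ q), ?_⟩
    rw [← hfacf, ← hTb, hfacb, mul_pow, ← pow_mul]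
  obtain ⟨-, hgdiv⟩ := dvd_of_X_pow_mul_dvd (not_X_dvd_pow hGb (N + 1)) hdiv
  set r := Ab * (N + 1) - a with hr
  -- the slices: `g| ∣ (s · G_b|)^(r + N + 1)`
  have hslice : TupleGame.slice i g ∣ (X 0 * TupleGame.slice i Gb) ^ (r + N + 1) := by
    obtain ⟨u, hu⟩ := hgdiv
    have hs := congrArg (TupleGame.slice i) hu
    rw [MultiplicityLift.slice_X_zero_pow_mul, slice_mul, slice_pow] at hs
    refine ⟨X 0 ^ (N + 1) * TupleGame.slice i Gb ^ r * TupleGame.slice i u, ?_⟩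
    calc (X 0 * TupleGame.slice i Gb) ^ (r + N + 1)
        = X 0 ^ (N + 1) * TupleGame.slice i Gb ^ r * (X 0 ^ r * TupleGame.slice i Gb ^ (N + 1)) := by ring
      _ = X 0 ^ (N + 1) * TupleGame.slice i Gb ^ r * (TupleGame.slice i g * TupleGame.slice i u) := by rw [hs]
      _ = TupleGame.slice i g * (X 0 ^ (N + 1) * TupleGame.slice i Gb ^ r * TupleGame.slice i u) := by ring
  have hne : X 0 * TupleGame.slice i Gb ≠ 0 :=
    mul_ne_zero (MvPowerSeries.prime_X' k (0 : Fin (m + 1))).ne_zero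
      (TupleDropAssembly.slice_ne_zero (subst Φ b) w c' hc' hw1 Ab Gb hfacb hGb i hci)
  -- induction at the new position (value `β < α`), then the tame successor step
  have hsliceWon : CobordantGame.Won k (m + 1) (TupleGame.slice i g) := ih β hβ _ hne hwini (r + N) _ hslice
  exact TameSuccessor.won_successor_of_won_slice p hp (subst Φ f) w c' hc' a g hfacf i hci
    (TameSuccessor.not_dvd_of_le_one hp hw1 hwi) hsliceWon

/-- **(RD_m) ⇒ every non-zero germ in `m + 1` variables is won** in the weighted game: one ordinal rank lowered at every answer of some
smooth-centre move from every non-zero non-NC germ suffices (`winsOrd_of_rankDrop`, p525270, then `won_of_winsOrd`). [OURS · L1 W4.3] -/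
theorem won_of_rankDrop (p : ℕ) (hp : p.Prime) [CharP k p] (m : ℕ)
    (hdrop : ∃ ρ : MvPowerSeries (Fin (m + 1)) k → Ordinal.{0}, ∀ b : MvPowerSeries (Fin (m + 1)) k, b ≠ 0 → ¬ GermIsNC b →
      ∃ (Φ : Fin (m + 1) → MvPowerSeries (Fin (m + 1)) k) (w : Fin (m + 1) → ℕ),
        IsCountMove Φ w ∧ MoveClause b Φ w (fun b' => ρ b' < ρ b))
    (f : MvPowerSeries (Fin (m + 1)) k) (hf : f ≠ 0) : CobordantGame.Won k (m + 1) f := by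
  obtain ⟨ρ, hρ⟩ := hdrop
  obtain ⟨α, hα⟩ := winsOrd_of_rankDrop (P := GermIsNC) ρ hρ f hf
  exact won_of_winsOrd p hp α f hf hα 0 f (by rw [zero_add, pow_one])

/-- **THE TUPLE GAME IN `n + 1` VARIABLES FROM (RD_n)** (every field; the generic form of `tupleDropThree_of_ncRankDrop`, p526032):
game value ⇒ ordinal count (i)(ii)(iii) (`rank_of_winsOrd`) ⇒ the ordinal assembly with the landed monomial phase `germMonomialPhase` (p506875's
generic theorem). [OURS · L1 W4.3] -/
theorem tupleDrop_of_ncRankDrop (k : Type) [Field k] (n : ℕ)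
    (hdrop : ∃ ρ : MvPowerSeries (Fin (n + 1)) k → Ordinal.{0}, ∀ b : MvPowerSeries (Fin (n + 1)) k, b ≠ 0 → ¬ GermIsNC b →
      ∃ (Φ : Fin (n + 1) → MvPowerSeries (Fin (n + 1)) k) (w : Fin (n + 1) → ℕ),
        IsCountMove Φ w ∧ MoveClause b Φ w (fun b' => ρ b' < ρ b)) :
    ∀ e : ℕ, TupleGame.Drop k (n + 1) e := by
  obtain ⟨ρ, hρ⟩ := hdrop
  have hwin := winsOrd_of_rankDrop (P := GermIsNC) ρ hρ
  have hP : ∀ (N : ℕ) (b d : MvPowerSeries (Fin (n + 1)) k), d ≠ 0 → GermIsNC d → b ∣ d ^ (N + 1) → GermIsNC b :=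
    fun N b d hd hnc hdvd => germIsNC_of_dvd_pow N b d hd hnc hdvd
  obtain ⟨ν, h1, h2, h3⟩ := rank_of_winsOrd GermIsNC hP hwin
  exact tupleDrop_of_rank_of_monomialPhase n GermIsNC ν h1 h2 h3 (germMonomialPhase k n)

/-! ### The residual stubs of v32 BY NAME from (RD) -/

/-- **W4|₄ = `stub_wildWideApexFourStartsWon` (v32, statement VERBATIM) from (RD₃)** — the ordinal rank-drop statement for the NC count game on
`k⟦x₀,x₁,x₂,x₃⟧`, i.e. the text of the registered stub `stub_spaceNCRankDrop` ONE DIMENSION UP. [OURS · L1 W4.3] -/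
theorem wildWideApexFourStartsWon_of_ncRankDrop
    (hdrop : ∀ (p : ℕ), p.Prime → ∀ (k : Type) [Field k] [CharP k p] [IsAlgClosed k],
      ∃ ρ : MvPowerSeries (Fin 4) k → Ordinal.{0}, ∀ b : MvPowerSeries (Fin 4) k, b ≠ 0 → ¬ GermIsNC b →
        ∃ (Φ : Fin 4 → MvPowerSeries (Fin 4) k) (w : Fin 4 → ℕ),
          IsCountMove (m := 3) Φ w ∧ MoveClause (m := 3) b Φ w (fun b' => ρ b' < ρ b)) :
    ∀ (p : ℕ), p.Prime → ∀ (k : Type) [Field k] [CharP k p] [IsAlgClosed k],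
      (∀ m : ℕ, m < 4 → ∀ g : MvPowerSeries (Fin m) k,
        CobordantGame.IsSingular k g → CobordantGame.Won k m g) →
      ∀ (f : MvPowerSeries (Fin 4) k), CobordantGame.IsSingular k f →
      (∀ g : MvPowerSeries (Fin 4) k, CobordantGame.IsSingular k g → g.order < f.order →
        CobordantGame.Won k 4 g) →
      ∀ (d : ℕ), f.order = d → p ∣ d →
      (∃ ℓ : Fin 4 → k, ∀ i j : Fin 4,
        MvPowerSeries.coeff (Finsupp.single i 1 + Finsupp.single j 1) f =
          MvPowerSeries.coeff (Finsupp.single i 1 + Finsupp.single j 1)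
            ((∑ l, MvPowerSeries.C (ℓ l) * MvPowerSeries.X l) ^ 2)) →
      (2 < d → ∃ c₁ c₂ : Fin 4 → k, (∀ α β : k, α • c₁ + β • c₂ = 0 → α = 0 ∧ β = 0) ∧
        (∀ v : Fin 4 → k, CobordantChart.initEval (fun _ : Fin 4 => 1) (v + c₁) d f =
          CobordantChart.initEval (fun _ : Fin 4 => 1) v d f) ∧
        (∀ v : Fin 4 → k, CobordantChart.initEval (fun _ : Fin 4 => 1) (v + c₂) d f =
          CobordantChart.initEval (fun _ : Fin 4 => 1) v d f)) →
      CobordantGame.Won k 4 f := by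
  intro p hp k _ _ _ _ f hf _ _ _ _ _ _
  exact won_of_rankDrop p hp 3 (hdrop p hp k) f hf.1

/-- **W4|₅₊ = `stub_wildWideApexFiveUpStartsWon` (v32, statement VERBATIM) from (RD_{n+4})** (the NC count game on `n + 5` variables, ordinal
form). [OURS · L1 W4.3] -/
theorem wildWideApexFiveUpStartsWon_of_ncRankDrop
    (hdrop : ∀ (p : ℕ), p.Prime → ∀ (k : Type) [Field k] [CharP k p] [IsAlgClosed k] (n : ℕ),
      ∃ ρ : MvPowerSeries (Fin (n + 5)) k → Ordinal.{0}, ∀ b : MvPowerSeries (Fin (n + 5)) k, b ≠ 0 → ¬ GermIsNC b →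
        ∃ (Φ : Fin (n + 5) → MvPowerSeries (Fin (n + 5)) k) (w : Fin (n + 5) → ℕ),
          IsCountMove (m := n + 4) Φ w ∧ MoveClause (m := n + 4) b Φ w (fun b' => ρ b' < ρ b)) :
    ∀ (p : ℕ), p.Prime → ∀ (k : Type) [Field k] [CharP k p] [IsAlgClosed k]
      (n : ℕ), (∀ m : ℕ, m < n + 5 → ∀ g : MvPowerSeries (Fin m) k,
        CobordantGame.IsSingular k g → CobordantGame.Won k m g) →
      ∀ (f : MvPowerSeries (Fin (n + 5)) k), CobordantGame.IsSingular k f →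
      (∀ g : MvPowerSeries (Fin (n + 5)) k, CobordantGame.IsSingular k g → g.order < f.order →
        CobordantGame.Won k (n + 5) g) →
      ∀ (d : ℕ), f.order = d → p ∣ d →
      (∃ ℓ : Fin (n + 5) → k, ∀ i j : Fin (n + 5),
        MvPowerSeries.coeff (Finsupp.single i 1 + Finsupp.single j 1) f =
          MvPowerSeries.coeff (Finsupp.single i 1 + Finsupp.single j 1)
            ((∑ l, MvPowerSeries.C (ℓ l) * MvPowerSeries.X l) ^ 2)) →
      (2 < d → ∃ c₁ c₂ : Fin (n + 5) → k, (∀ α β : k, α • c₁ + β • c₂ = 0 → α = 0 ∧ β = 0) ∧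
        (∀ v : Fin (n + 5) → k, CobordantChart.initEval (fun _ : Fin (n + 5) => 1) (v + c₁) d f =
          CobordantChart.initEval (fun _ : Fin (n + 5) => 1) v d f) ∧
        (∀ v : Fin (n + 5) → k, CobordantChart.initEval (fun _ : Fin (n + 5) => 1) (v + c₂) d f =
          CobordantChart.initEval (fun _ : Fin (n + 5) => 1) v d f)) →
      CobordantGame.Won k (n + 5) f := by
  intro p hp k _ _ _ n _ f hf _ _ _ _ _ _
  exact won_of_rankDrop p hp (n + 4) (hdrop p hp k n) f hf.1

/-- **T″|₅₊ = `stub_tameWideApexFiveUpStartsWon` (v32, statement VERBATIM) from (RD_{n+3}) — the NC count game in ONE FEWER variable**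
(`n + 4` variables for germs in `n + 5`): the tame maximal-contact dimension drop (`TameLift.tameWon_of_tupleDrop`: Weierstrass–Tschirnhaus slice to the
coefficient-tuple game, p131880 lineage) composed with `tupleDrop_of_ncRankDrop`.  Ordinal form of res-type-088's `tameWideApexHigherStartsWon_of_tot_of_mono`
(p506334).  In particular T″|₅ costs (RD₃), the same statement as W4|₄. [OURS · L1 W4.3] -/
theorem tameWideApexFiveUpStartsWon_of_ncRankDropBelow
    (hdrop : ∀ (p : ℕ), p.Prime → ∀ (k : Type) [Field k] [CharP k p] [IsAlgClosed k] (n : ℕ),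
      ∃ ρ : MvPowerSeries (Fin (n + 4)) k → Ordinal.{0}, ∀ b : MvPowerSeries (Fin (n + 4)) k, b ≠ 0 → ¬ GermIsNC b →
        ∃ (Φ : Fin (n + 4) → MvPowerSeries (Fin (n + 4)) k) (w : Fin (n + 4) → ℕ),
          IsCountMove (m := n + 3) Φ w ∧ MoveClause (m := n + 3) b Φ w (fun b' => ρ b' < ρ b)) :
    ∀ (p : ℕ), p.Prime → ∀ (k : Type) [Field k] [CharP k p] [IsAlgClosed k]
    (n : ℕ), (∀ m : ℕ, m < n + 5 → ∀ g : MvPowerSeries (Fin m) k,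
      CobordantGame.IsSingular k g → CobordantGame.Won k m g) →
    ∀ (f : MvPowerSeries (Fin (n + 5)) k), CobordantGame.IsSingular k f →
    (∀ g : MvPowerSeries (Fin (n + 5)) k, CobordantGame.IsSingular k g → g.order < f.order →
      CobordantGame.Won k (n + 5) g) →
    ∀ (d : ℕ), f.order = d → ¬ p ∣ d →
    (∃ ℓ : Fin (n + 5) → k, ∀ i j : Fin (n + 5),
      MvPowerSeries.coeff (Finsupp.single i 1 + Finsupp.single j 1) f =
        MvPowerSeries.coeff (Finsupp.single i 1 + Finsupp.single j 1)
          ((∑ l, MvPowerSeries.C (ℓ l) * MvPowerSeries.X l) ^ 2)) →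
    (2 < d → ∃ c₁ c₂ : Fin (n + 5) → k, (∀ α β : k, α • c₁ + β • c₂ = 0 → α = 0 ∧ β = 0) ∧
      (∀ v : Fin (n + 5) → k, CobordantChart.initEval (fun _ : Fin (n + 5) => 1) (v + c₁) d f =
        CobordantChart.initEval (fun _ : Fin (n + 5) => 1) v d f) ∧
      (∀ v : Fin (n + 5) → k, CobordantChart.initEval (fun _ : Fin (n + 5) => 1) (v + c₂) d f =
        CobordantChart.initEval (fun _ : Fin (n + 5) => 1) v d f)) →
    CobordantGame.Won k (n + 5) f := by
  intro p hp k _ _ _ n _ f hf hord d hfd hpd _ _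
  exact TameLift.tameWon_of_tupleDrop p hp k (n + 4) (tupleDrop_of_ncRankDrop k (n + 3) (hdrop p hp k n)) f hf hord d hfd hpd

end NCTransport

end Summit.ResolutionOfSingularities.ResolutionOfSingularities.Theorems

end
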